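import Mathlib
import HarnessLib

/-!
# Kronecker families, tensor powers, permutation operators and polarization (gauge-boot, FFT 1/7)

HONEST FRAMING (cell `pub-gaugeboot`, page 1 of every file): the venture produces certified bounds
on lattice expectations at stated coupling, gauge group, dimension and torus size; NOT a mass gap,
NOT a continuum limit, NOT a string tension; NOT Yang–Mills-summit-bearing (barriers
`FixedCouplingUltralocality`, `PerturbativeInvisibility`). This module is pure linear algebra
(matrices indexed by words `κ → n` of colour indices); it certifies no number. It is the first
brick of the lane's FIRST FUNDAMENTAL THEOREM for lattice gauge invariants (H. Weyl, *The Classical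
Groups* (1939) Ch. II/VII; B. Durhuus, Lett. Math. Phys. 4 (1980) 515–522; A. Sengupta, Proc. AMS
121 (1994) 897–905, Thm. 2): the gauge-invariant polynomial observables of `SU(N)`/`U(N)` lattice
gauge theory are generated by Wilson loops — i.e. the unknowns of the Kazakov–Zheng bootstrap
(multi-trace Wilson loops) are ALL the gauge-invariant data.

## Content (commutative ring `R`; slots `κ`, colours `n`, both finite)

* `kron A` — the Kronecker product of a family `A : κ → Matrix n n R`, the matrix on `κ → n` with
  entries `∏ k, A k (x k) (y k)`; `kronPow X = kron (fun _ => X)` — the tensor power `X^{⊗κ}`;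
  `kron_mul` (slotwise products), `kron_one`, `kronPow_mul`, `kron_conjTranspose`,
  `kron_update_add` / `kron_update_smul` (multilinearity in each slot).
* `permMat σ` (`σ : Equiv.Perm κ`) — the permutation operator of the slots, entries
  `[y = x ∘ σ]`; `permMat_mul` (a representation of `Equiv.Perm κ`), `permMat_mul_apply`,
  `mul_permMat_apply`, ★ `permMat_mul_kronPow` (tensor powers commute with slot permutations).
* `twistTrace τ L = ∑ c, ∏ k, L k (c k) (c (τ k))` — the `τ`-twisted contraction of a family of
  letters (for `τ` a cycle: the trace of the product of the letters along the cycle); this is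
  the shape in which products of Wilson loops come out of Haar averages (FFT 4/7, 5/7);
  `trace_kron_mul_permMat`.
* ★★ `sum_perm_kron_comp` — POLARIZATION: `∑_σ kron (A ∘ σ) = ∑_S (-1)^{|κ|-|S|} kronPow (∑_{i∈S} A i)`
  (inclusion–exclusion over the functions `κ → κ` with range in `S`).
  The sequel `TensorPowerSymmetric.lean` turns this into: slot-symmetric matrices are spanned by
  tensor powers (the half `End_{S_κ}(V^{⊗κ}) ⊆ span {X^{⊗κ}}` of Schur–Weyl duality).

Elementary; the statements are textbook (Weyl; Goodman–Wallach GTM 255 §4.2.4), not located in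
Mathlib (`lean search`: no Schur–Weyl / first fundamental theorem).
-/

namespace Summit.QuantumFields.GaugeBoot

namespace TensorFFT

open Matrix Finset

variable {κ n R : Type*} [CommRing R]

section Basic

variable [Fintype κ]

/-! ## Kronecker families and tensor powers -/

/-- **Kronecker product of a family of matrices** indexed by the slots `κ`: the matrix on words
`κ → n` with entries `∏ k, A k (x k) (y k)`. [folklore] -/
def kron (A : κ → Matrix n n R) : Matrix (κ → n) (κ → n) R :=
  Matrix.of fun x y => ∏ k, A k (x k) (y k)

/-- `kron` evaluated. -/
@[simp] theorem kron_apply (A : κ → Matrix n n R) (x y : κ → n) :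
    kron A x y = ∏ k, A k (x k) (y k) := rfl

/-- **Tensor power** `X^{⊗κ}` of a matrix: `kron` of the constant family. [folklore] -/
def kronPow (X : Matrix n n R) : Matrix (κ → n) (κ → n) R := kron fun _ : κ => X

/-- `kronPow` evaluated. -/
@[simp] theorem kronPow_apply (X : Matrix n n R) (x y : κ → n) :
    (kronPow X : Matrix (κ → n) (κ → n) R) x y = ∏ k, X (x k) (y k) := rfl

/-- `kronPow X = kron (fun _ => X)`. -/
theorem kronPow_eq_kron (X : Matrix n n R) :
    (kronPow X : Matrix (κ → n) (κ → n) R) = kron fun _ : κ => X := rfl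

/-- Conjugate transpose of a Kronecker family (star rings): slotwise. -/
theorem kron_conjTranspose [StarRing R] (A : κ → Matrix n n R) :
    (kron A)ᴴ = kron fun k => (A k)ᴴ := by
  ext x y
  simp only [conjTranspose_apply, kron_apply, star_prod]

/-- Transpose of a Kronecker family: slotwise. -/
theorem kron_transpose (A : κ → Matrix n n R) : (kron A)ᵀ = kron fun k => (A k)ᵀ := by
  ext x y
  simp only [transpose_apply, kron_apply]

section Update

variable [DecidableEq κ]

/-- Entries of `kron` of an updated family: the updated slot factors out. -/
theorem prod_update_apply (A : κ → Matrix n n R) (k : κ) (Z : Matrix n n R) (x y : κ → n) :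
    ∏ j, Function.update A k Z j (x j) (y j) = Z (x k) (y k) * ∏ j ∈ univ.erase k, A j (x j) (y j) := by
  rw [← mul_prod_erase univ _ (mem_univ k), Function.update_self]
  refine congrArg _ (prod_congr rfl fun j hj => ?_)
  rw [Function.update_of_ne (ne_of_mem_erase hj)]

/-- `kron` is additive in each slot. -/
theorem kron_update_add (A : κ → Matrix n n R) (k : κ) (X Y : Matrix n n R) :
    kron (Function.update A k (X + Y)) = kron (Function.update A k X) + kron (Function.update A k Y) := by
  ext x y
  simp only [Matrix.add_apply, kron_apply, prod_update_apply, add_mul]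

/-- `kron` is homogeneous in each slot. -/
theorem kron_update_smul (A : κ → Matrix n n R) (k : κ) (c : R) (X : Matrix n n R) :
    kron (Function.update A k (c • X)) = c • kron (Function.update A k X) := by
  ext x y
  simp only [Matrix.smul_apply, kron_apply, prod_update_apply, smul_eq_mul, mul_assoc]

end Update

section One

variable [DecidableEq n]

/-- `kron 1 = 1`. -/
@[simp] theorem kron_one : kron (1 : κ → Matrix n n R) = 1 := by
  ext x y
  simp only [kron_apply, Pi.one_apply, Matrix.one_apply]
  rw [prod_boole]
  simp only [mem_univ, forall_const, funext_iff]

/-- `kron (fun _ => 1) = 1`. -/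
@[simp] theorem kron_const_one : kron (fun _ : κ => (1 : Matrix n n R)) = 1 := kron_one

/-- `kronPow 1 = 1`. -/
@[simp] theorem kronPow_one : (kronPow (1 : Matrix n n R) : Matrix (κ → n) (κ → n) R) = 1 := kron_one

/-! ## Permutation operators of the slots -/

/-- **Slot permutation operator** `P_σ` on words `κ → n`: entries `[y = x ∘ σ]`. [folklore] -/
def permMat (σ : Equiv.Perm κ) : Matrix (κ → n) (κ → n) R :=
  Matrix.of fun x y => if y = x ∘ σ then 1 else 0

/-- `permMat` evaluated. -/
@[simp] theorem permMat_apply (σ : Equiv.Perm κ) (x y : κ → n) :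
    (permMat σ : Matrix (κ → n) (κ → n) R) x y = if y = x ∘ σ then 1 else 0 := rfl

/-- `P_1 = 1`. -/
@[simp] theorem permMat_one : (permMat (1 : Equiv.Perm κ) : Matrix (κ → n) (κ → n) R) = 1 := by
  ext x y
  simp only [permMat_apply, Equiv.Perm.coe_one, Function.comp_id, Matrix.one_apply]
  by_cases h : x = y
  · simp [h]
  · simp [h, Ne.symm h]

end One

section Mul

variable [DecidableEq κ] [Fintype n]

/-- ★ **Slotwise multiplicativity**: `kron A * kron B = kron (A · B)`. -/
theorem kron_mul (A B : κ → Matrix n n R) : kron A * kron B = kron fun k => A k * B k := by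
  ext x y
  simp only [Matrix.mul_apply, kron_apply]
  rw [Fintype.prod_sum (fun k j => A k (x k) j * B k j (y k))]
  exact Finset.sum_congr rfl fun z _ => prod_mul_distrib.symm

/-- ★ `kronPow (X * Y) = kronPow X * kronPow Y`. -/
theorem kronPow_mul (X Y : Matrix n n R) :
    (kronPow (X * Y) : Matrix (κ → n) (κ → n) R) = kronPow X * kronPow Y := by
  rw [kronPow_eq_kron, kronPow_eq_kron, kronPow_eq_kron, kron_mul]

/-! ## Twisted traces -/

/-- **The `τ`-twisted contraction** of a family of letters `L : κ → Matrix n n R`: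
`∑_c ∏_k L k (c k) (c (τ k))` — for a cycle `τ = (k₁ k₂ … k_r)` this is
`tr (L k₁ L k₂ ⋯ L k_r)`, and in general the product over the cycles of `τ`. [folklore] -/
def twistTrace (τ : Equiv.Perm κ) (L : κ → Matrix n n R) : R :=
  ∑ c : κ → n, ∏ k, L k (c k) (c (τ k))

/-- `twistTrace` unfolded. -/
theorem twistTrace_def (τ : Equiv.Perm κ) (L : κ → Matrix n n R) :
    twistTrace τ L = ∑ c : κ → n, ∏ k, L k (c k) (c (τ k)) := rfl

end Mul

section All

variable [DecidableEq κ] [Fintype n] [DecidableEq n]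

/-- `kron` as a monoid homomorphism from families of matrices (slotwise product). -/
def kronHom : (κ → Matrix n n R) →* Matrix (κ → n) (κ → n) R where
  toFun := kron
  map_one' := kron_one
  map_mul' A B := (kron_mul A B).symm

/-- `kronHom A = kron A`. -/
@[simp] theorem kronHom_apply (A : κ → Matrix n n R) : kronHom A = kron A := rfl

/-- Left multiplication by `P_σ` permutes the row word: `(P_σ M) x y = M (x ∘ σ) y`. -/
theorem permMat_mul_apply (σ : Equiv.Perm κ) (M : Matrix (κ → n) (κ → n) R) (x y : κ → n) :
    (permMat σ * M : Matrix (κ → n) (κ → n) R) x y = M (x ∘ σ) y := by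
  simp only [Matrix.mul_apply, permMat_apply, ite_mul, one_mul, zero_mul]
  rw [sum_ite_eq' univ (x ∘ ⇑σ)]
  simp

/-- Right multiplication by `P_σ` permutes the column word: `(M P_σ) x y = M x (y ∘ σ⁻¹)`. -/
theorem mul_permMat_apply (σ : Equiv.Perm κ) (M : Matrix (κ → n) (κ → n) R) (x y : κ → n) :
    (M * permMat σ : Matrix (κ → n) (κ → n) R) x y = M x (y ∘ σ.symm) := by
  simp only [Matrix.mul_apply, permMat_apply, mul_ite, mul_one, mul_zero]
  have h : ∀ z : κ → n, (y = z ∘ σ) ↔ (z = y ∘ σ.symm) := fun z => by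
    constructor
    · rintro rfl; funext k; simp
    · rintro rfl; funext k; simp
  simp_rw [h]
  rw [sum_ite_eq' univ (y ∘ ⇑σ.symm)]
  simp

/-- ★ **`σ ↦ P_σ` is a representation**: `P_{στ} = P_σ P_τ`. -/
theorem permMat_mul (σ τ : Equiv.Perm κ) :
    (permMat (σ * τ) : Matrix (κ → n) (κ → n) R) = permMat σ * permMat τ := by
  ext x y
  rw [permMat_mul_apply, permMat_apply, permMat_apply, Equiv.Perm.coe_mul, Function.comp_assoc]

/-- `P_σ P_{σ⁻¹} = 1`. -/
theorem permMat_mul_permMat_inv (σ : Equiv.Perm κ) :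
    (permMat σ : Matrix (κ → n) (κ → n) R) * permMat σ⁻¹ = 1 := by
  rw [← permMat_mul, mul_inv_cancel, permMat_one]

/-- ★ **Slot permutations intertwine Kronecker families**: `P_σ · kron (A ∘ σ) = kron A · P_σ`. -/
theorem permMat_mul_kron (σ : Equiv.Perm κ) (A : κ → Matrix n n R) :
    permMat σ * kron (fun k => A (σ k)) = kron A * permMat σ := by
  ext x y
  rw [permMat_mul_apply, mul_permMat_apply, kron_apply, kron_apply]
  exact Fintype.prod_equiv σ (fun k => A (σ k) ((x ∘ ⇑σ) k) (y k))
    (fun k => A k (x k) ((y ∘ ⇑σ.symm) k)) fun k => by simp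

/-- ★ **Tensor powers commute with slot permutations**: `P_σ X^{⊗κ} = X^{⊗κ} P_σ`. -/
theorem permMat_mul_kronPow (σ : Equiv.Perm κ) (X : Matrix n n R) :
    permMat σ * (kronPow X : Matrix (κ → n) (κ → n) R) = kronPow X * permMat σ :=
  permMat_mul_kron σ fun _ => X

/-- `Commute (permMat σ) (kronPow X)`. -/
theorem commute_permMat_kronPow (σ : Equiv.Perm κ) (X : Matrix n n R) :
    Commute (permMat σ) (kronPow X : Matrix (κ → n) (κ → n) R) :=
  permMat_mul_kronPow σ X

/-- ★ `tr (kron L · P_τ) = twistTrace τ⁻¹ L`: twisted traces are traces against slot permutations. -/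
theorem trace_kron_mul_permMat (τ : Equiv.Perm κ) (L : κ → Matrix n n R) :
    (kron L * permMat τ).trace = twistTrace τ⁻¹ L := by
  unfold Matrix.trace twistTrace
  refine sum_congr rfl fun x _ => ?_
  rw [Matrix.diag_apply, mul_permMat_apply, kron_apply]
  rfl

end All

/-! ## Polarization: symmetrised Kronecker families are combinations of tensor powers -/

section Polarization

variable [DecidableEq κ]

/-- A tensor power of a finite sum expands over the functions choosing one summand per slot. -/
theorem kronPow_sum (A : κ → Matrix n n R) (S : Finset κ) :
    (kronPow (∑ i ∈ S, A i) : Matrix (κ → n) (κ → n) R) =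
      ∑ f ∈ Fintype.piFinset (fun _ : κ => S), kron (fun k => A (f k)) := by
  ext x y
  simp only [kronPow_apply, Matrix.sum_apply, kron_apply]
  exact prod_univ_sum (fun _ : κ => S) (fun k i => A i (x k) (y k))

/-- Inclusion–exclusion weight: `∑_{S ⊇ T} (-1)^{|κ|-|S|} = [T = univ]`. -/
theorem sum_ite_superset_neg_one_pow (T : Finset κ) :
    ∑ S : Finset κ, (if T ⊆ S then (-1 : R) ^ (Fintype.card κ - S.card) else 0) =
      if T = univ then 1 else 0 := by
  rw [← sum_filter]
  have h : ∑ S ∈ univ.filter (fun S : Finset κ => T ⊆ S), (-1 : R) ^ (Fintype.card κ - S.card) =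
      ∑ U ∈ (univ \ T).powerset, (-1 : R) ^ U.card := by
    refine sum_nbij' (fun S => univ \ S) (fun U => univ \ U) ?_ ?_ ?_ ?_ ?_
    · intro S hS
      simp only [mem_filter, mem_univ, true_and, mem_powerset] at hS ⊢
      exact sdiff_subset_sdiff (Subset.refl _) hS
    · intro U hU
      simp only [mem_filter, mem_univ, true_and, mem_powerset] at hU ⊢
      rw [subset_sdiff] at hU ⊢
      exact ⟨subset_univ _, hU.2.symm⟩
    · intro S _; simp
    · intro U _; simp
    · intro S _; rw [card_univ_sdiff]
  have hz : (∑ U ∈ (univ \ T).powerset, (-1 : R) ^ U.card) =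
      ((∑ U ∈ (univ \ T).powerset, (-1 : ℤ) ^ U.card : ℤ) : R) := by
    push_cast; rfl
  rw [h, hz, sum_powerset_neg_one_pow_card]
  by_cases hT : T = univ
  · simp [hT]
  · have hne : univ \ T ≠ ∅ := by
      rwa [Ne, sdiff_eq_empty_iff_subset, univ_subset_iff]
    simp [hT, hne]

/-- ★★ **POLARIZATION IDENTITY for Kronecker families**: the symmetrisation of `kron A` over the
slots is an alternating sum of tensor powers of partial sums,
`∑_σ kron (A ∘ σ) = ∑_S (-1)^{|κ|-|S|} (∑_{i∈S} A i)^{⊗κ}`. [folklore] -/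
theorem sum_perm_kron_comp (A : κ → Matrix n n R) :
    ∑ σ : Equiv.Perm κ, kron (fun k => A (σ k)) =
      ∑ S : Finset κ, (-1 : R) ^ (Fintype.card κ - S.card) •
        (kronPow (∑ i ∈ S, A i) : Matrix (κ → n) (κ → n) R) := by
  classical
  -- expand each tensor power over functions `f : κ → κ` with range in `S`
  have h1 : ∀ S : Finset κ, (kronPow (∑ i ∈ S, A i) : Matrix (κ → n) (κ → n) R) =
      ∑ f : κ → κ, if univ.image f ⊆ S then kron (fun k => A (f k)) else 0 := by
    intro S
    rw [kronPow_sum, ← sum_filter]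
    refine sum_congr ?_ fun _ _ => rfl
    ext f
    simp only [Fintype.mem_piFinset, mem_filter, mem_univ, true_and, image_subset_iff,
      forall_true_left]
  simp_rw [h1, smul_sum, smul_ite, smul_zero]
  rw [sum_comm]
  -- collect the coefficient of each `f`
  have h2 : ∀ f : κ → κ, (∑ S : Finset κ, if univ.image f ⊆ S then
      (-1 : R) ^ (Fintype.card κ - S.card) • kron (fun k => A (f k)) else 0) =
      if Function.Bijective f then kron (fun k => A (f k)) else 0 := by
    intro f
    have e : (∑ S : Finset κ, if univ.image f ⊆ S then
        (-1 : R) ^ (Fintype.card κ - S.card) • kron (fun k => A (f k)) else 0) =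
        (∑ S : Finset κ, if univ.image f ⊆ S then (-1 : R) ^ (Fintype.card κ - S.card) else 0) •
          kron (fun k => A (f k)) := by
      rw [sum_smul]
      exact sum_congr rfl fun S _ => by split_ifs <;> simp
    rw [e, sum_ite_superset_neg_one_pow]
    have hb : (univ.image f = univ) ↔ Function.Bijective f := by
      rw [← Finite.surjective_iff_bijective, eq_univ_iff_forall]
      constructor
      · intro h y
        obtain ⟨x, _, hx⟩ := mem_image.1 (h y)
        exact ⟨x, hx⟩
      · intro h y
        obtain ⟨x, hx⟩ := h y
        exact mem_image.2 ⟨x, mem_univ _, hx⟩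
    by_cases hf : Function.Bijective f
    · rw [if_pos (hb.2 hf), if_pos hf, one_smul]
    · rw [if_neg (fun h => hf (hb.1 h)), if_neg hf, zero_smul]
  simp_rw [h2]
  rw [← sum_filter]
  refine sum_bij (fun (σ : Equiv.Perm κ) _ => (⇑σ : κ → κ)) ?_ ?_ ?_ ?_
  · intro σ _; exact mem_filter.2 ⟨mem_univ _, σ.bijective⟩
  · intro σ _ τ _ h; exact Equiv.ext (congrFun h)
  · intro f hf
    exact ⟨Equiv.ofBijective f (mem_filter.1 hf).2, mem_univ _, rfl⟩
  · intro σ _; rfl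

end Polarization

end Basic

end TensorFFT

end Summit.QuantumFields.GaugeBoot
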